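import Mathlib
import Literature.Combinatorics.Additive.TPPGroupAlgebra
import Literature.Computability.AlgebraicComplexity.CohnUmansTPP
import Literature.Combinatorics.Enumerative.EntropyBregman
import Summits.MatrixMultiplication.MatrixMultiplication.Theorems.SnSubsetDichotomyGlobalBranchStubQuotientCard
import Summits.MatrixMultiplication.MatrixMultiplication.Theorems.SnSubsetDichotomyGlobalBranchStubQuotientSpread
import Summits.MatrixMultiplication.MatrixMultiplication.Theorems.SnSubsetDichotomyGlobalBranchThinQuotient

/-!
# `SnSubsetDichotomy.GlobalBranch`, line `bregman-entropy-window` — the Cuckler–Kahn pre-filter (KL-biased quotient sets)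

Crux `stmt-MatrixMultiplication-8303` (`…Theses.SnSubsetDichotomy.GlobalBranch`), line `bregman-entropy-window`
(lead's skeleton `Cruxes/GlobalBranch/Lines/bregman_entropy_window.lean`, seat c1).  This file lands the ENTROPY
half of the line's provable content — the planner's original lever, now a theorem: the Cuckler–Kahn inequality for
the uniform measure on a set of permutations (`Literature.Combinatorics.Enumerative.exists_spread_log_card_add_kl_le`,
proved in the tree this session) applied to the QUOTIENT SET `S⁻¹T` of a TPP triple, whose size is `#S·#T`
(`stub_quotientCard`) and whose marginals are as spread as those of `S` (`stub_quotientSpread`).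

* `klBiasedQuotient_subthreshold` — for every `δ > 0` there are `η > 0`, `n₀` such that every TPP triple
  `(S, T, U)` in `S_n`, `n ≥ n₀`, with `η`-spread marginals of `S` (`#{s ∈ S : s i = j} ≤ η·#S`) whose quotient set
  `S⁻¹T` has total level-1 Kullback–Leibler defect `∑_i (log n − H(row_i(S⁻¹T))) ≥ δ n` (a LINEARLY biased
  quotient marginal matrix `D_T D_Sᵀ`) satisfies `#S #T #U ≤ (n!)^{3/2} e^{−δ n/4}` — far below the threshold
  `(n!)^{3/2} e^{−c√n}` of the crux;
* `klBiasedSet_subthreshold` — likewise if `S` itself is `η`-spread and sits below the entropy window,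
  `∑_i (log n − H(row_i(S))) ≥ ½ log n! + δ n`: then `#S #T #U ≤ (n!)^{3/2} e^{−δ n/2}`.

(By `TripleProductProperty.rotate` the same holds for the other quotient sets / sets; level `t = 1` of the crux's
bump-free hypothesis gives the spreadness for large `n`, as the skeleton's `spread_of_bumpFree` records.)  Together
with the support-side `thinQuotient_subthreshold` (`…ThinQuotient.lean`) this is everything the line proves outright;
what survives is its registered residual `stub_thickQuotientResidual` (support-thick AND KL-flat quotients and sets).
-/

set_option linter.dupNamespace false
set_option autoImplicit false

namespace Summit.MatrixMultiplication.MatrixMultiplication.Theorems.GlobalBranch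

open scoped BigOperators Classical
open Finset
open Literature.Combinatorics.Additive

variable {n : ℕ}

/-- From a logarithmic volume bound `log(#S #T #U) ≤ (3/2) log n! − E` to `#S #T #U ≤ (n!)^{3/2} e^{−E}`.
[folklore] -/
theorem volume_le_of_log_le_gen {S T U : Finset (Equiv.Perm (Fin n))} (hS : S.Nonempty) (hT : T.Nonempty)
    (hU : U.Nonempty) {E : ℝ}
    (h : Real.log (S.card : ℝ) + Real.log (T.card : ℝ) + Real.log (U.card : ℝ) ≤
      3 / 2 * Real.log (n.factorial : ℝ) - E) :
    ((S.card * T.card * U.card : ℕ) : ℝ) ≤ (n.factorial : ℝ) ^ ((3 : ℝ) / 2) * Real.exp (-E) := by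
  have hF : (0 : ℝ) < (n.factorial : ℝ) := by exact_mod_cast n.factorial_pos
  have hSpos : (0 : ℝ) < S.card := by exact_mod_cast hS.card_pos
  have hTpos : (0 : ℝ) < T.card := by exact_mod_cast hT.card_pos
  have hUpos : (0 : ℝ) < U.card := by exact_mod_cast hU.card_pos
  have hbound : (0 : ℝ) < (n.factorial : ℝ) ^ ((3 : ℝ) / 2) * Real.exp (-E) := by positivity
  have hV : ((S.card * T.card * U.card : ℕ) : ℝ) = (S.card : ℝ) * T.card * U.card := by push_cast; ring
  have hVpos : (0 : ℝ) < (S.card : ℝ) * T.card * U.card := by positivity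
  have hlogV : Real.log ((S.card : ℝ) * T.card * U.card) =
      Real.log S.card + Real.log T.card + Real.log U.card := by
    rw [Real.log_mul (by positivity) hUpos.ne', Real.log_mul hSpos.ne' hTpos.ne']
  have hlogB : Real.log ((n.factorial : ℝ) ^ ((3 : ℝ) / 2) * Real.exp (-E)) =
      3 / 2 * Real.log n.factorial - E := by
    rw [Real.log_mul (Real.rpow_pos_of_pos hF _).ne' (Real.exp_pos _).ne', Real.log_rpow hF, Real.log_exp]
    ring
  rw [hV, ← Real.log_le_log_iff hVpos hbound, hlogB, hlogV]
  exact h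

/-- Spreadness passes from `S` to the quotient set `S⁻¹T` (for a pairwise-injective pair): if every fibre
`#{s ∈ S : s i = j}` is at most `η·#S`, then every marginal probability of the uniform measure on `S⁻¹T` is at
most `η`.  Counting core: `stub_quotientSpread` with `m = ⌊η #S⌋`, and `#(S⁻¹T) = #S #T` (`stub_quotientCard`).
[cite: CohnUmans2003, Lemma 3.1] -/
theorem quot_spread {η : ℝ} {S T : Finset (Equiv.Perm (Fin n))} (hS : S.Nonempty) (hT : T.Nonempty)
    (hinj : ∀ s ∈ S, ∀ s' ∈ S, ∀ t ∈ T, ∀ t' ∈ T, s⁻¹ * t = s'⁻¹ * t' → s = s' ∧ t = t') (hη : 0 ≤ η)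
    (hsp : ∀ i j : Fin n, ((S.filter (fun σ => σ i = j)).card : ℝ) ≤ η * (S.card : ℝ)) (i j : Fin n) :
    ((((Finset.image₂ (fun s t => s⁻¹ * t) S T).filter (fun a => a i = j)).card : ℝ) /
        ((Finset.image₂ (fun s t => s⁻¹ * t) S T).card : ℝ)) ≤ η := by
  have hSpos : (0 : ℝ) < S.card := by exact_mod_cast hS.card_pos
  have hTpos : (0 : ℝ) < T.card := by exact_mod_cast hT.card_pos
  set m : ℕ := ⌊η * (S.card : ℝ)⌋₊ with hm
  have hfib : ∀ k : Fin n, (S.filter (fun s => s j = k)).card ≤ m := fun k => Nat.le_floor (hsp j k)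
  have hD := stub_quotientSpread n S T i j m hfib
  have hmle : (m : ℝ) ≤ η * (S.card : ℝ) := Nat.floor_le (by positivity)
  have hcard : (Finset.image₂ (fun s t => s⁻¹ * t) S T).card = S.card * T.card := stub_quotientCard n S T hinj
  rw [hcard, Nat.cast_mul, div_le_iff₀ (by positivity)]
  calc ((((Finset.image₂ (fun s t => s⁻¹ * t) S T).filter (fun a => a i = j)).card : ℝ))
        ≤ (T.card : ℝ) * m := by exact_mod_cast hD
    _ ≤ (T.card : ℝ) * (η * S.card) := mul_le_mul_of_nonneg_left hmle hTpos.le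
    _ = η * ((S.card : ℝ) * T.card) := by ring

/-- **The Cuckler–Kahn pre-filter (KL-biased quotient set).**  For every `δ > 0` there are `η > 0` and `n₀`
(those of `exists_spread_log_card_add_kl_le (δ/2)`: `η = min(1/2, (δ/16)²)`, `n₀ = max 2 ⌈4/δ⌉`) such that for all
`n ≥ n₀` and every TPP triple `(S, T, U)` in `S_n` with `η`-spread marginals of `S`: if the quotient set
`S⁻¹T = image₂ (fun s t => s⁻¹ * t) S T` has total level-1 Kullback–Leibler defect
`∑_i (log n − ∑_j negMulLog (#{a ∈ S⁻¹T : a i = j} / #(S⁻¹T))) ≥ δ n`, then `#S #T #U ≤ (n!)^{3/2} e^{−δ n / 4}`.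
(Cuckler–Kahn for `S⁻¹T`, whose size is `#S #T` and whose marginals are spread, plus the two packing bounds
`#T #U, #U #S ≤ n!`.) [cite: CucklerKahn2009, §1 (main theorem, bipartite case)] -/
theorem klBiasedQuotient_subthreshold : ∀ δ : ℝ, 0 < δ → ∃ η : ℝ, 0 < η ∧ ∃ n₀ : ℕ, ∀ n ≥ n₀,
    ∀ S T U : Finset (Equiv.Perm (Fin n)), TripleProductProperty S T U →
      (∀ i j : Fin n, ((S.filter (fun σ => σ i = j)).card : ℝ) ≤ η * (S.card : ℝ)) →
      δ * n ≤ ∑ i : Fin n, (Real.log (n : ℝ) - ∑ j : Fin n,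
          Real.negMulLog ((((Finset.image₂ (fun s t => s⁻¹ * t) S T).filter (fun a => a i = j)).card : ℝ) /
            ((Finset.image₂ (fun s t => s⁻¹ * t) S T).card : ℝ))) →
        ((S.card * T.card * U.card : ℕ) : ℝ) ≤
          (n.factorial : ℝ) ^ ((3 : ℝ) / 2) * Real.exp (-(δ / 4 * n)) := by
  intro δ hδ
  obtain ⟨η, hη, n₀, hCK⟩ :=
    Literature.Combinatorics.Enumerative.exists_spread_log_card_add_kl_le (δ / 2) (by positivity)
  refine ⟨η, hη, n₀, ?_⟩
  intro n hn S T U hTPP hsp hbig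
  have hbound : (0 : ℝ) ≤ (n.factorial : ℝ) ^ ((3 : ℝ) / 2) * Real.exp (-(δ / 4 * n)) := by positivity
  rcases S.eq_empty_or_nonempty with hS | hS
  · simp [hS, hbound]
  rcases T.eq_empty_or_nonempty with hT | hT
  · simp [hT, hbound]
  rcases U.eq_empty_or_nonempty with hU | hU
  · simp [hU, hbound]
  have hinj := pairInj_of_tpp' hTPP hU
  have hcard : (Finset.image₂ (fun s t => s⁻¹ * t) S T).card = S.card * T.card := stub_quotientCard n S T hinj
  have hQ : (Finset.image₂ (fun s t => s⁻¹ * t) S T).Nonempty := by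
    rw [← Finset.card_pos, hcard]
    exact Nat.mul_pos hS.card_pos hT.card_pos
  have hspQ := quot_spread hS hT hinj hη.le hsp
  have hk := hCK n hn _ hQ hspQ
  have hSpos : (0 : ℝ) < S.card := by exact_mod_cast hS.card_pos
  have hTpos : (0 : ℝ) < T.card := by exact_mod_cast hT.card_pos
  have hlog : Real.log ((Finset.image₂ (fun s t => s⁻¹ * t) S T).card : ℝ) =
      Real.log (S.card : ℝ) + Real.log (T.card : ℝ) := by
    rw [hcard, Nat.cast_mul, Real.log_mul hSpos.ne' hTpos.ne']
  rw [hlog] at hk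
  have lTU := log_card_add_log_card_le_log_factorial hTPP.rotate hT hU hS
  have lUS := log_card_add_log_card_le_log_factorial hTPP.rotate.rotate hU hS hT
  exact volume_le_of_log_le_gen hS hT hU (by linarith)

/-- **The Cuckler–Kahn pre-filter (set below the entropy window).**  For every `δ > 0` there are `η > 0` and
`n₀` such that for all `n ≥ n₀` and every TPP triple `(S, T, U)` in `S_n` with `η`-spread marginals of `S`: if
`∑_i (log n − ∑_j negMulLog (#{s ∈ S : s i = j} / #S)) ≥ ½ log n! + δ n` (the marginal entropies of `S` average
below `½ log n + ½ − δ`, up to Stirling), then `#S #T #U ≤ (n!)^{3/2} e^{−δ n / 2}`.  (Cuckler–Kahn for `S` plus the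
packing bound `#T #U ≤ n!`.) [cite: CucklerKahn2009, §1 (main theorem, bipartite case)] -/
theorem klBiasedSet_subthreshold : ∀ δ : ℝ, 0 < δ → ∃ η : ℝ, 0 < η ∧ ∃ n₀ : ℕ, ∀ n ≥ n₀,
    ∀ S T U : Finset (Equiv.Perm (Fin n)), TripleProductProperty S T U →
      (∀ i j : Fin n, ((S.filter (fun σ => σ i = j)).card : ℝ) ≤ η * (S.card : ℝ)) →
      Real.log (n.factorial : ℝ) / 2 + δ * n ≤ ∑ i : Fin n, (Real.log (n : ℝ) - ∑ j : Fin n,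
          Real.negMulLog (((S.filter (fun σ => σ i = j)).card : ℝ) / (S.card : ℝ))) →
        ((S.card * T.card * U.card : ℕ) : ℝ) ≤
          (n.factorial : ℝ) ^ ((3 : ℝ) / 2) * Real.exp (-(δ / 2 * n)) := by
  intro δ hδ
  obtain ⟨η, hη, n₀, hCK⟩ :=
    Literature.Combinatorics.Enumerative.exists_spread_log_card_add_kl_le (δ / 2) (by positivity)
  refine ⟨η, hη, n₀, ?_⟩
  intro n hn S T U hTPP hsp hbig
  have hbound : (0 : ℝ) ≤ (n.factorial : ℝ) ^ ((3 : ℝ) / 2) * Real.exp (-(δ / 2 * n)) := by positivity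
  rcases S.eq_empty_or_nonempty with hS | hS
  · simp [hS, hbound]
  rcases T.eq_empty_or_nonempty with hT | hT
  · simp [hT, hbound]
  rcases U.eq_empty_or_nonempty with hU | hU
  · simp [hU, hbound]
  have hSpos : (0 : ℝ) < S.card := by exact_mod_cast hS.card_pos
  have hspS : ∀ i j : Fin n, ((S.filter (fun σ => σ i = j)).card : ℝ) / (S.card : ℝ) ≤ η :=
    fun i j => by rw [div_le_iff₀ hSpos]; exact hsp i j
  have hk := hCK n hn S hS hspS
  have lTU := log_card_add_log_card_le_log_factorial hTPP.rotate hT hU hS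
  exact volume_le_of_log_le_gen hS hT hU (by linarith)

end Summit.MatrixMultiplication.MatrixMultiplication.Theorems.GlobalBranch
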